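import Summits.HubbardSuperconductivity.HubbardSuperconductivity.Theorems.EnslavedA1gTorusNormalForms
import Literature.MathematicalPhysics.QuantumLattice.HubbardGroundStateDoublonBound
import HarnessLib

/-!
# Crux `NoOnsiteODLRO` (stmt-HubbardSuperconductivity-0933) — reduced-channel domination `P_sᴴ P_s ≤ 2L² · D`
# and the window-free on-site ceiling `S_L ≤ 8 N L² / U`

Helper file of route-prover seat `LiebTwin-1` for the crux `NoOnsiteODLRO` (routes `LiebTwin`, `EnslavedA1g`),
serving the registered helper stub `stub_reducedChannelDomination` — the one CLOSED-part operator inequality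
(`ReducedChannelDomination`) of crux idea `Cruxes/NoOnsiteODLRO/Ideas/shastry-secant-reduced-bcs.md` that its
`Sketch.lean` only typed — and its elementary consequences:

* `posSemidef_card_smul_sum_conjTranspose_mul_sub` — **operator Cauchy–Schwarz**: for a finite family of
  square complex matrices, `(Σ_i A_i)ᴴ(Σ_i A_i) ≤ #s · Σ_i A_iᴴA_i` (Loewner order); twice the difference is
  the Gram sum `Σ_{i,j} (A_i − A_j)ᴴ(A_i − A_j)` (`sum_sum_conjTranspose_sub_mul_sub`); vector form
  `re_star_dotProduct_sum_conjTranspose_mul_sum_mulVec_le` (`‖Σ_i A_iψ‖² ≤ #s Σ_i ‖A_iψ‖²`).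
* `reducedChannelDomination` / `stub_reducedChannelDomination` — on the Fock space of the torus `(ℤ/Lℤ)²`,
  **`(2L²) · hubbardTorus 2 L 0 1 − (pairField sWave L)ᴴ (pairField sWave L)` is positive semidefinite**, i.e.
  `P_sᴴP_s ≤ 2L²·D` with `P_s = √2 Σ_x c_{x↑}c_{x↓}` (`EnslavedA1g.pairField_sWave`) and
  `D = hubbardTorus 2 L 0 1 = Σ_x n_{x↑}n_{x↓}` (`hubbardTorus_zero_one_eq_sum_doublon`; `A_xᴴA_x = n_{x↑}n_{x↓}`,
  `conjTranspose_onsitePair_mul_self`). Equivalently, Parseval over pair momenta: `D = Σ_q b_qᴴb_q ≥ b_0ᴴb_0 =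
  η₀ᴴη₀/L²` — the repulsion `U·D` CONTAINS the reduced `s`-wave BCS channel `(U/L²)η₀ᴴη₀` as a positive summand
  (the card's "sign of `U` spent once"). Vector form `re_expect_pairField_sWave_le_doublon`.
* `mul_re_expect_pairField_sWave_groundState_le`, `onsiteDensity_le_windowFree` — with the doublon bound
  `U⟨D⟩ ≤ 4N‖ψ‖²` (`hubbardTorus_groundState_doublon_le`): `U·S ≤ 8NL²‖ψ‖²` for every `(2n, 0)`-sector ground
  state, and along the crux's admissible sequences `S_L/L⁴ ≤ 8(1−δ)/U` at every even `L ≥ 3` — the "trivial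
  `S_L ≤ 2L²⟨D⟩ = O(L⁴/U)`" ceiling quoted by `LiebTwinNoOnsiteODLROLargeUCondensateBound`, needing no pair window
  (cf. `onsiteDensity_le_of_window`, `LiebTwinNoOnsiteODLROPseudospinDensity`).

None of this proves the crux (`S_L = o(L⁴)` at fixed `U`): these are `O(L⁴)` density ceilings. The energy
consequences (on-site secant, absorption of a reduced BCS attraction by a shift of `U`, coupling-transport
ceiling) are in `LiebTwinNoOnsiteODLROCouplingTransport`.

Sources: C. N. Yang, Rev. Mod. Phys. 34 (1962) 694, §3 (ODLRO eigenvalue bounds for fermion pairs);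
R. Bhatia, *Positive Definite Matrices* (2007), §1.3; H. Tasaki, J. Phys. Cond. Matt. 10 (1998) 4353, §5.1.
Folklore bookkeeping on tree definitions (`pairField`, `sWave`, `hubbardTorus`, `IsGroundStateInSector`); no
definition and no named fact is introduced.
-/

noncomputable section

set_option linter.dupNamespace false

namespace Summit.HubbardSuperconductivity.HubbardSuperconductivity.Theorems.NoOnsiteODLRO.ReducedChannel

open Matrix Finset
open Literature.Probability.LatticeModels Literature.MathematicalPhysics.QuantumLattice
open scoped ComplexOrder

/-! ### Operator Cauchy–Schwarz over a finite family -/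

section OperatorCauchySchwarz

variable {α : Type*} {n : Type*} [Fintype n]

/-- **Doubled Lagrange identity for matrices**: for a finite family of square complex matrices `A_i` (`i ∈ s`),
`Σ_{i,j ∈ s} (A_i − A_j)ᴴ(A_i − A_j) = 2·(#s · Σ_i A_iᴴA_i − (Σ_i A_i)ᴴ(Σ_i A_i))`. Bhatia, *Positive Definite
Matrices* (2007), §1.3. [folklore] -/
theorem sum_sum_conjTranspose_sub_mul_sub (s : Finset α) (A : α → Matrix n n ℂ) :
    ∑ i ∈ s, ∑ j ∈ s, (A i - A j)ᴴ * (A i - A j) =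
      (2 : ℂ) • ((s.card : ℂ) • ∑ i ∈ s, (A i)ᴴ * A i - (∑ i ∈ s, A i)ᴴ * ∑ i ∈ s, A i) := by
  set S : Matrix n n ℂ := ∑ i ∈ s, A i with hS
  set Q : Matrix n n ℂ := ∑ i ∈ s, (A i)ᴴ * A i with hQ
  have hexp : ∀ i j, (A i - A j)ᴴ * (A i - A j) =
      ((A i)ᴴ * A i + (A j)ᴴ * A j) - ((A i)ᴴ * A j + (A j)ᴴ * A i) := by
    intro i j
    rw [conjTranspose_sub, sub_mul, mul_sub, mul_sub]
    abel
  have h1 : ∑ i ∈ s, ∑ _j ∈ s, (A i)ᴴ * A i = (s.card : ℂ) • Q := by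
    simp_rw [Finset.sum_const]
    rw [← Finset.smul_sum, Nat.cast_smul_eq_nsmul]
  have h2 : ∑ _i ∈ s, ∑ j ∈ s, (A j)ᴴ * A j = (s.card : ℂ) • Q := by
    rw [Finset.sum_const, Nat.cast_smul_eq_nsmul]
  have h3 : ∑ i ∈ s, ∑ j ∈ s, (A i)ᴴ * A j = Sᴴ * S := by
    rw [hS, conjTranspose_sum, Finset.sum_mul_sum]
  have h4 : ∑ i ∈ s, ∑ j ∈ s, (A j)ᴴ * A i = Sᴴ * S := by
    rw [Finset.sum_comm, h3]
  simp_rw [hexp, Finset.sum_sub_distrib, Finset.sum_add_distrib]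
  rw [h1, h2, h3, h4, two_smul]
  abel

/-- **Operator Cauchy–Schwarz (doubled form).** For a finite family of square matrices `A_i`,
`2 · (#s · Σ_i A_iᴴ A_i − (Σ_i A_i)ᴴ (Σ_i A_i)) = Σ_{i,j} (A_i − A_j)ᴴ (A_i − A_j)` is positive
semidefinite. [folklore] -/
theorem posSemidef_two_smul_card_smul_sum_sub (s : Finset α) (A : α → Matrix n n ℂ) :
    ((2 : ℂ) • ((s.card : ℂ) • ∑ i ∈ s, (A i)ᴴ * A i - (∑ i ∈ s, A i)ᴴ * ∑ i ∈ s, A i)).PosSemidef := by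
  rw [← sum_sum_conjTranspose_sub_mul_sub]
  exact posSemidef_sum _ fun i _ => posSemidef_sum _ fun j _ => posSemidef_conjTranspose_mul_self _

/-- **Operator Cauchy–Schwarz.** For a finite family of square complex matrices `A_i` (`i ∈ s`),
`(Σ_i A_i)ᴴ (Σ_i A_i) ≤ #s · Σ_i A_iᴴ A_i` in the Loewner order, i.e.
`#s · Σ_i A_iᴴ A_i − (Σ_i A_i)ᴴ (Σ_i A_i)` is positive semidefinite (twice it is the sum of the
Gram squares `(A_i − A_j)ᴴ(A_i − A_j)`). Bhatia, *Positive Definite Matrices* (2007), §1.3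
(convexity of `A ↦ AᴴA`). [folklore] -/
theorem posSemidef_card_smul_sum_conjTranspose_mul_sub (s : Finset α) (A : α → Matrix n n ℂ) :
    ((s.card : ℂ) • ∑ i ∈ s, (A i)ᴴ * A i - (∑ i ∈ s, A i)ᴴ * ∑ i ∈ s, A i).PosSemidef := by
  have h := (posSemidef_two_smul_card_smul_sum_sub s A).smul (a := ((2⁻¹ : ℝ) : ℂ))
    (Complex.zero_le_real.2 (by norm_num))
  rwa [smul_smul, show ((2⁻¹ : ℝ) : ℂ) * 2 = 1 by push_cast; norm_num, one_smul] at h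

/-- Vector form of the operator Cauchy–Schwarz inequality: for every vector `ψ`,
`Re⟨ψ, (Σ_i A_i)ᴴ(Σ_i A_i) ψ⟩ ≤ #s · Σ_i Re⟨ψ, A_iᴴ A_i ψ⟩` (`‖Σ_i A_iψ‖² ≤ #s Σ_i ‖A_iψ‖²`). [folklore] -/
theorem re_star_dotProduct_sum_conjTranspose_mul_sum_mulVec_le (s : Finset α) (A : α → Matrix n n ℂ)
    (ψ : n → ℂ) :
    (star ψ ⬝ᵥ (((∑ i ∈ s, A i)ᴴ * ∑ i ∈ s, A i) *ᵥ ψ)).re ≤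
      s.card * ∑ i ∈ s, (star ψ ⬝ᵥ (((A i)ᴴ * A i) *ᵥ ψ)).re := by
  have h := (posSemidef_card_smul_sum_conjTranspose_mul_sub s A).dotProduct_mulVec_nonneg ψ
  rw [sub_mulVec, dotProduct_sub, sub_nonneg] at h
  have h' := (Complex.le_def.1 h).1
  rwa [smul_mulVec, dotProduct_smul, smul_eq_mul, ← Complex.ofReal_natCast, Complex.re_ofReal_mul,
    sum_mulVec, dotProduct_sum, Complex.re_sum] at h'

end OperatorCauchySchwarz

/-! ### The on-site pair annihilator and the doublon operator -/

section OnsitePair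

variable {Λ : Type*} [LinearOrder Λ] [Fintype Λ]

/-- `(c_{x↑} c_{x↓})ᴴ (c_{x↑} c_{x↓}) = n_{x↑} n_{x↓}`: the Gram square of the on-site pair annihilator is the
doublon projector (CAR bookkeeping: `c†_{↓} n_{↑} = n_{↑} c†_{↓}`). Yang, PRL 63 (1989) 2144, eq. (4). [folklore] -/
theorem conjTranspose_onsitePair_mul_self (x : Λ) :
    (annihilation (orb x 0) * annihilation (orb x 1))ᴴ * (annihilation (orb x 0) * annihilation (orb x 1)) =
      numberOp x 0 * numberOp x 1 := by
  have h01 : orb x 0 ≠ orb x 1 := by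
    intro h
    have := congrArg (fun o : Orb Λ => (ofLex o).2) h
    simp [orb] at this
  rw [conjTranspose_mul, annihilation_conjTranspose, annihilation_conjTranspose]
  calc creation (orb x 1) * creation (orb x 0) * (annihilation (orb x 0) * annihilation (orb x 1))
      = creation (orb x 1) * (creation (orb x 0) * annihilation (orb x 0)) * annihilation (orb x 1) := by
        simp only [mul_assoc]
    _ = creation (orb x 0) * annihilation (orb x 0) * creation (orb x 1) * annihilation (orb x 1) := by
        rw [← number_mul_creation_of_ne h01]
    _ = numberOp x 0 * numberOp x 1 := by
        rw [numberOp, numberOp, mul_assoc]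

end OnsitePair

/-! ### Reduced-channel domination on the Hubbard torus -/

section Torus

variable (L : ℕ) [NeZero L]

omit [NeZero L] in
/-- The doublon operator of the torus in the tree's vocabulary: `hubbardTorus 2 L 0 1 = Σ_x n_{x↑} n_{x↓}`
(hopping amplitude `t = 0`, coupling `U = 1`). [folklore] -/
theorem hubbardTorus_zero_one_eq_sum_doublon :
    hubbardTorus 2 L 0 1 = ∑ y : FermionTorus 2 L, numberOp y 0 * numberOp y 1 := by
  simp [hubbardTorus, hamiltonian]

/-- The doublon operator as a sum of Gram squares of on-site pair annihilators, indexed by torus sites: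
`Σ_x n_{x↑}n_{x↓} = Σ_x (c_{x↑}c_{x↓})ᴴ(c_{x↑}c_{x↓})`. [folklore] -/
theorem hubbardTorus_zero_one_eq_sum_gram :
    hubbardTorus 2 L 0 1 = ∑ x : TorusSite 2 L,
      (annihilation (orb (FermionTorus.ofTorusSite x) 0) * annihilation (orb (FermionTorus.ofTorusSite x) 1))ᴴ *
        (annihilation (orb (FermionTorus.ofTorusSite x) 0) * annihilation (orb (FermionTorus.ofTorusSite x) 1)) := by
  rw [hubbardTorus_zero_one_eq_sum_doublon]
  exact Fintype.sum_equiv FermionTorus.equivTorusSite _ _ fun y => by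
    rw [conjTranspose_onsitePair_mul_self]
    simp [FermionTorus.equivTorusSite]

/-- `P_sᴴ P_s = 2 · (Σ_x c_{x↑}c_{x↓})ᴴ (Σ_x c_{x↑}c_{x↓})` (`P_s = pairField sWave L = √2 Σ_x c_{x↑}c_{x↓}`).
Scalapino, Phys. Rep. 250 (1995) 329, §2. [folklore] -/
theorem conjTranspose_pairField_sWave_mul_self_eq_two_smul :
    (pairField sWave L)ᴴ * pairField sWave L = (2 : ℂ) •
      ((∑ x : TorusSite 2 L, annihilation (orb (FermionTorus.ofTorusSite x) 0) *
          annihilation (orb (FermionTorus.ofTorusSite x) 1))ᴴ *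
        ∑ x : TorusSite 2 L, annihilation (orb (FermionTorus.ofTorusSite x) 0) *
          annihilation (orb (FermionTorus.ofTorusSite x) 1)) := by
  have hP : pairField sWave L = ((Real.sqrt 2 : ℝ) : ℂ) •
      ∑ x : TorusSite 2 L, annihilation (orb (FermionTorus.ofTorusSite x) 0) *
        annihilation (orb (FermionTorus.ofTorusSite x) 1) := by
    rw [EnslavedA1g.pairField_sWave, ← Finset.smul_sum]
  have h2 : star ((Real.sqrt 2 : ℝ) : ℂ) * ((Real.sqrt 2 : ℝ) : ℂ) = 2 := by
    rw [Complex.star_def, Complex.conj_ofReal, ← Complex.ofReal_mul, Real.mul_self_sqrt zero_le_two,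
      Complex.ofReal_ofNat]
  rw [hP, conjTranspose_smul, Matrix.smul_mul, Matrix.mul_smul, smul_smul, h2]

/-- **Reduced-channel domination** (`ReducedChannelDomination` of crux idea `shastry-secant-reduced-bcs`):
on the whole Fock space of the torus `(ℤ/Lℤ)²`,

  `P_sᴴ P_s ≤ 2L² · D`,  i.e.  `(2L²) · hubbardTorus 2 L 0 1 − (pairField sWave L)ᴴ (pairField sWave L)` is PSD,

`P_s = √2 Σ_x c_{x↑}c_{x↓}` the on-site pair field, `D = Σ_x n_{x↑}n_{x↓}` the doublon operator. Operator
Cauchy–Schwarz over the `L²` sites (`(Σ_x A_x)ᴴ(Σ_x A_x) ≤ L² Σ_x A_xᴴA_x` with `A_xᴴA_x = n_{x↑}n_{x↓}`);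
equivalently Parseval over pair momenta, `D = Σ_q b_qᴴ b_q ≥ b_0ᴴ b_0 = η₀ᴴη₀/L²`. This is the one place the
repulsive interaction `U·D` CONTAINS the reduced `s`-wave BCS channel `(U/L²)·η₀ᴴη₀` as a positive summand.
Yang, Rev. Mod. Phys. 34 (1962) 694, §3 (ODLRO eigenvalue bound for hard-core pairs); census card
`Cruxes/NoOnsiteODLRO/Ideas/shastry-secant-reduced-bcs.md`. [folklore] -/
theorem reducedChannelDomination :
    ((2 * (L : ℂ) ^ 2) • hubbardTorus 2 L 0 1 - (pairField sWave L)ᴴ * pairField sWave L).PosSemidef := by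
  have hcard : ((Finset.univ : Finset (TorusSite 2 L)).card : ℂ) = (L : ℂ) ^ 2 := by
    rw [Finset.card_univ]
    simp [ZMod.card]
  rw [hubbardTorus_zero_one_eq_sum_gram, conjTranspose_pairField_sWave_mul_self_eq_two_smul, ← smul_smul,
    ← smul_sub, ← hcard]
  exact posSemidef_two_smul_card_smul_sum_sub _ _

/-- **Reduced-channel domination, vector form**: for every Fock vector `ψ` of the torus,
`Re⟨ψ, P_sᴴP_s ψ⟩ ≤ 2L² · Re⟨ψ, D ψ⟩` (`D = hubbardTorus 2 L 0 1 = Σ_x n_{x↑}n_{x↓}`): the on-site pair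
structure factor is at most `2L²` times the doublon number. Yang, Rev. Mod. Phys. 34 (1962) 694, §3. [folklore] -/
theorem re_expect_pairField_sWave_le_doublon (ψ : Fock (Orb (FermionTorus 2 L))) :
    (expect ((pairField sWave L)ᴴ * pairField sWave L) ψ).re ≤
      2 * (L : ℝ) ^ 2 * (expect (hubbardTorus 2 L 0 1) ψ).re := by
  have h := (reducedChannelDomination L).dotProduct_mulVec_nonneg ψ
  rw [sub_mulVec, dotProduct_sub, sub_nonneg] at h
  have h' := (Complex.le_def.1 h).1
  rw [smul_mulVec, dotProduct_smul, smul_eq_mul, show (2 * (L : ℂ) ^ 2) = ((2 * (L : ℝ) ^ 2 : ℝ) : ℂ) by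
    push_cast; ring, Complex.re_ofReal_mul] at h'
  exact h'

/-- **Window-free on-site ceiling for repulsive ground states**: for `L ≥ 3`, `U > 0`... precisely, for every
real `U`, `2n ≤ L²` and every ground state `ψ` of `hubbardTorus 2 L 1 U` in the sector `(2n, S^z = 0)`,
`U · Re⟨ψ, P_sᴴP_s ψ⟩ ≤ 8 · (2n) · L² · ‖ψ‖²` — reduced-channel domination `S ≤ 2L²⟨D⟩` combined with the
doublon bound `U⟨D⟩ ≤ 4N‖ψ‖²` (`hubbardTorus_groundState_doublon_le`). The "trivial `S_L ≤ 2L²⟨D⟩ = O(L⁴/U)`"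
ceiling quoted in `LiebTwinNoOnsiteODLROLargeUCondensateBound`, needing no pair window. Tasaki, J. Phys. Cond.
Matt. 10 (1998) 4353, §5.1; Yang, Rev. Mod. Phys. 34 (1962) 694, §3. [folklore] -/
theorem mul_re_expect_pairField_sWave_groundState_le (hL : 3 ≤ L) (U : ℝ) {n : ℕ} (hn : 2 * n ≤ L ^ 2)
    {ψ : Fock (Orb (FermionTorus 2 L))} (hψ : IsGroundStateInSector (hubbardTorus 2 L 1 U) (2 * n) 0 ψ) :
    U * (expect ((pairField sWave L)ᴴ * pairField sWave L) ψ).re ≤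
      8 * (2 * n : ℕ) * (L : ℝ) ^ 2 * (star ψ ⬝ᵥ ψ).re := by
  have h1 := re_expect_pairField_sWave_le_doublon L ψ
  have h2 := hubbardTorus_groundState_doublon_le L hL U hn hψ
  rw [← hubbardTorus_zero_one_eq_sum_doublon L] at h2
  change U * (expect (hubbardTorus 2 L 0 1) ψ).re ≤ _ at h2
  by_cases hU : 0 ≤ U
  · calc U * (expect ((pairField sWave L)ᴴ * pairField sWave L) ψ).re
        ≤ U * (2 * (L : ℝ) ^ 2 * (expect (hubbardTorus 2 L 0 1) ψ).re) := mul_le_mul_of_nonneg_left h1 hU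
      _ = 2 * (L : ℝ) ^ 2 * (U * (expect (hubbardTorus 2 L 0 1) ψ).re) := by ring
      _ ≤ 2 * (L : ℝ) ^ 2 * (4 * (2 * n : ℕ) * (star ψ ⬝ᵥ ψ).re) :=
          mul_le_mul_of_nonneg_left h2 (by positivity)
      _ = 8 * (2 * n : ℕ) * (L : ℝ) ^ 2 * (star ψ ⬝ᵥ ψ).re := by ring
  · have hU : U < 0 := lt_of_not_ge hU
    have hS : 0 ≤ (expect ((pairField sWave L)ᴴ * pairField sWave L) ψ).re := by
      have h := (posSemidef_conjTranspose_mul_self (pairField sWave L)).dotProduct_mulVec_nonneg ψ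
      exact (Complex.le_def.1 h).1.trans_eq rfl
    have hnorm : 0 ≤ (star ψ ⬝ᵥ ψ).re := (Complex.nonneg_iff.1 (dotProduct_star_self_nonneg ψ)).1
    calc U * (expect ((pairField sWave L)ᴴ * pairField sWave L) ψ).re ≤ 0 :=
          mul_nonpos_of_nonpos_of_nonneg hU.le hS
      _ ≤ 8 * (2 * n : ℕ) * (L : ℝ) ^ 2 * (star ψ ⬝ᵥ ψ).re := by positivity

/-- **Window-free on-site pair DENSITY ceiling along admissible sequences** (the crux's own vocabulary): for
`U > 0`, `δ ∈ (0, 1/2)` and an admissible `(N_L, S^z = 0)`-sector ground-state sequence `ψ_L` of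
`hubbardTorus 2 L 1 U` (`N_L = 2⌊(1-δ)L²/2⌋`, `‖ψ_L‖ = 1`), at EVERY even side `L ≥ 3`:
`S_L / L⁴ ≤ 8(1 - δ)/U`, `S_L = Re⟨ψ_L, P_sᴴP_s ψ_L⟩`. An `O(1)` ceiling, vanishing only as `U → ∞`; it
does not prove the crux `NoOnsiteODLRO` (`∀ ε`) and is informative only beyond Yang's kinematic bound, but it is
unconditional (no strict pair window, cf. `onsiteDensity_le_of_window`). Tasaki (1998) §5.1; Yang (1962) §3.
[folklore] -/
theorem onsiteDensity_le_windowFree {U δ : ℝ} (hU : 0 < U) (hδ : δ ∈ Set.Ioo (0 : ℝ) (1 / 2))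
    (N : ℕ → ℕ) (ψ : ∀ L, Fock (Orb (FermionTorus 2 L)))
    (hadm : ∀ L, Even L → N L = 2 * ⌊(1 - δ) * (L : ℝ) ^ 2 / 2⌋₊ ∧ star (ψ L) ⬝ᵥ ψ L = 1 ∧
      IsGroundStateInSector (hubbardTorus 2 L 1 U) (N L) 0 (ψ L))
    (L : ℕ) [NeZero L] (hLe : Even L) (hL : 3 ≤ L) :
    (expect ((pairField sWave L)ᴴ * pairField sWave L) (ψ L)).re / (L : ℝ) ^ 4 ≤ 8 * (1 - δ) / U := by
  obtain ⟨hN, hnorm, hgs⟩ := hadm L hLe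
  set m : ℕ := ⌊(1 - δ) * (L : ℝ) ^ 2 / 2⌋₊ with hm
  have hδ1 : 0 ≤ 1 - δ := by linarith [hδ.2]
  have hy : 0 ≤ (1 - δ) * (L : ℝ) ^ 2 / 2 := by positivity
  have hfloor : (m : ℝ) ≤ (1 - δ) * (L : ℝ) ^ 2 / 2 := Nat.floor_le hy
  have h2m_real : (2 * m : ℕ) ≤ (1 - δ) * (L : ℝ) ^ 2 := by push_cast; linarith
  have h2m : 2 * m ≤ L ^ 2 := by
    have h : ((2 * m : ℕ) : ℝ) ≤ ((L ^ 2 : ℕ) : ℝ) := by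
      refine h2m_real.trans ?_
      push_cast
      nlinarith [hδ.1, sq_nonneg (L : ℝ)]
    exact_mod_cast h
  rw [hN] at hgs
  have hmain := mul_re_expect_pairField_sWave_groundState_le L hL U h2m hgs
  rw [hnorm, Complex.one_re, mul_one] at hmain
  have hL0 : (0 : ℝ) < (L : ℝ) ^ 4 := by
    have : (0 : ℝ) < L := by exact_mod_cast (show 0 < L by omega)
    positivity
  rw [div_le_div_iff₀ hL0 hU]
  calc (expect ((pairField sWave L)ᴴ * pairField sWave L) (ψ L)).re * U
      = U * (expect ((pairField sWave L)ᴴ * pairField sWave L) (ψ L)).re := mul_comm _ _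
    _ ≤ 8 * (2 * m : ℕ) * (L : ℝ) ^ 2 := hmain
    _ ≤ 8 * ((1 - δ) * (L : ℝ) ^ 2) * (L : ℝ) ^ 2 := by gcongr
    _ = 8 * (1 - δ) * (L : ℝ) ^ 4 := by ring

end Torus

/-! ### Registered helper stub -/

/-- **Registered helper stub `stub_reducedChannelDomination`** of crux `NoOnsiteODLRO`
(stmt-HubbardSuperconductivity-0933; the closed-part operator inequality `ReducedChannelDomination` of crux idea
`shastry-secant-reduced-bcs`, NOT a piece of any line's composition `NoOnsiteODLRO_of`): on the Fock space of the
torus `(ℤ/Lℤ)²`, `(2L²) · hubbardTorus 2 L 0 1 − (pairField sWave L)ᴴ (pairField sWave L)` is positive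
semidefinite, i.e. `P_sᴴP_s ≤ 2L² · D`. Yang, Rev. Mod. Phys. 34 (1962) 694, §3. [folklore] -/
theorem stub_reducedChannelDomination : ∀ (L : ℕ) [NeZero L],
    ((2 * (L : ℂ) ^ 2) • hubbardTorus 2 L 0 1 - (pairField sWave L)ᴴ * pairField sWave L).PosSemidef :=
  fun L _ => reducedChannelDomination L



end Summit.HubbardSuperconductivity.HubbardSuperconductivity.Theorems.NoOnsiteODLRO.ReducedChannel
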